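import Literature.AlgebraicGeometry.Resolution.CubeMonomialCharts

/-!
# The stellar pair of monomial cube charts

For indices `i ≠ j` and positive integers `β, α` the **stellar exponent matrices**
`stellar i j β α` and `stellar j i α β` are the identity matrix with column `i` (resp. `j`)
replaced by `β eᵢ + α eⱼ`: their columns span the two maximal cones of the weighted stellar
subdivision of the positive orthant along the ray `β eᵢ + α eⱼ`.  Multiplicatively
(`MonomialCubeChart.monoMap`) they are the charts `v ↦ (…, vᵢ^β, …, vᵢ^α vⱼ, …)` and
`v ↦ (…, vⱼ^β vᵢ, …, vⱼ^α, …)` of the open unit cube, with images `{wⱼ^β < wᵢ^α}` and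
`{wᵢ^α < wⱼ^β}`: disjoint, and covering the cube up to the null hypersurface `wⱼ^β = wᵢ^α`
(the image of the hyperplane `vⱼ = 1`).  Main result: `isGoodFamily_stellar_pair`.  On the new
ray the linear form with values `α` on `eᵢ` and `-β` on `eⱼ` vanishes, which is what the
principalization algorithm (`CubeMonomialChartsPrincipalization`) uses.

Sources: folklore toric geometry (W. Fulton, *Introduction to toric varieties*, 1993, §2.6).
Not here: unimodular (smooth) subdivisions.
-/

noncomputable section

open Set MeasureTheory

namespace Literature.AlgebraicGeometry.Resolution

namespace MonomialCubeChart

variable {n : ℕ}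

/-! ## The stellar pair of charts -/

/-- The **stellar exponent matrix** `σ = stellar i j β α`: the identity matrix with its `i`-th
column replaced by `β eᵢ + α eⱼ`.  Its columns span one of the two maximal cones of the weighted
stellar subdivision of the positive orthant along `β eᵢ + α eⱼ` (the one containing `eⱼ`); the
other is `stellar j i α β`.  Multiplicatively `μ_σ v = (…, vᵢ^β, …, vᵢ^α·vⱼ, …)`
(Fulton 1993, §2.6). [folklore] -/
def stellar (i j : Fin n) (β α : ℕ) : Matrix (Fin n) (Fin n) ℕ :=
  (1 : Matrix (Fin n) (Fin n) ℕ).updateCol i (Pi.single i β + Pi.single j α)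

/-- Entries of the stellar matrix. [folklore] -/
theorem stellar_apply (i j : Fin n) (β α : ℕ) (k l : Fin n) :
    stellar i j β α k l =
      if l = i then (Pi.single i β + Pi.single j α : Fin n → ℕ) k
      else (1 : Matrix (Fin n) (Fin n) ℕ) k l := by
  simp only [stellar, Matrix.updateCol_apply]

/-- `det (stellar i j β α) = β` (Cramer's rule for the identity matrix). [folklore] -/
theorem det_stellar (i j : Fin n) (hij : i ≠ j) (β α : ℕ) :
    ((stellar i j β α).map (fun t : ℕ => (t : ℝ))).det = β := by
  rw [stellar, Matrix.map_updateCol, Matrix.map_one _ Nat.cast_zero Nat.cast_one,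
    ← Matrix.cramer_apply, Matrix.cramer_one]
  simp [hij]

/-- Components of the stellar chart: `μ_σ v = (…, vᵢ^β, …, vᵢ^α vⱼ, …)`. [folklore] -/
theorem monoMap_stellar_apply (i j : Fin n) (hij : i ≠ j) (β α : ℕ) (v : Fin n → ℝ) (k : Fin n) :
    monoMap (stellar i j β α) v k =
      if k = i then v i ^ β else if k = j then v i ^ α * v j else v k := by
  rw [monoMap_apply, ← Finset.mul_prod_erase Finset.univ _ (Finset.mem_univ i)]
  have h1 : ∀ l ∈ Finset.univ.erase i,
      v l ^ stellar i j β α k l = v l ^ (1 : Matrix (Fin n) (Fin n) ℕ) k l := by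
    intro l hl
    rw [stellar_apply, if_neg (Finset.ne_of_mem_erase hl)]
  rw [Finset.prod_congr rfl h1, stellar_apply, if_pos rfl]
  by_cases hk : k = i
  · rw [if_pos hk, hk, Finset.prod_eq_one (fun l hl => by
      rw [Matrix.one_apply_ne' (Finset.ne_of_mem_erase hl), pow_zero]), mul_one]
    simp [hij]
  · rw [if_neg hk, Finset.prod_eq_single k (fun l _ hlk => by
        rw [Matrix.one_apply_ne' hlk, pow_zero])
      (fun h => absurd (Finset.mem_erase.2 ⟨hk, Finset.mem_univ k⟩) h),
      Matrix.one_apply_eq, pow_one]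
    by_cases hkj : k = j
    · rw [if_pos hkj, hkj]
      simp [hij.symm]
    · rw [if_neg hkj]
      simp [hk, hkj]

/-- `(μ_σ v)ᵢ = vᵢ ^ β`. [folklore] -/
theorem monoMap_stellar_self {i j : Fin n} (hij : i ≠ j) (β α : ℕ) (v : Fin n → ℝ) :
    monoMap (stellar i j β α) v i = v i ^ β := by
  rw [monoMap_stellar_apply i j hij, if_pos rfl]

/-- `(μ_σ v)ⱼ = vᵢ ^ α vⱼ`. [folklore] -/
theorem monoMap_stellar_other {i j : Fin n} (hij : i ≠ j) (β α : ℕ) (v : Fin n → ℝ) :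
    monoMap (stellar i j β α) v j = v i ^ α * v j := by
  rw [monoMap_stellar_apply i j hij, if_neg hij.symm, if_pos rfl]

/-- `(μ_σ v)ₖ = vₖ` off `{i, j}`. [folklore] -/
theorem monoMap_stellar_ne {i j k : Fin n} (hij : i ≠ j) (hki : k ≠ i) (hkj : k ≠ j) (β α : ℕ)
    (v : Fin n → ℝ) : monoMap (stellar i j β α) v k = v k := by
  rw [monoMap_stellar_apply i j hij, if_neg hki, if_neg hkj]

/-- On the open cube the stellar chart lands in `{wⱼ^β < wᵢ^α}`. [folklore] -/
theorem stellar_ineq {i j : Fin n} (hij : i ≠ j) {β : ℕ} (hβ : β ≠ 0) (α : ℕ) {v : Fin n → ℝ}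
    (hv : v ∈ openCube n) :
    monoMap (stellar i j β α) v j ^ β < monoMap (stellar i j β α) v i ^ α := by
  rw [monoMap_stellar_self hij, monoMap_stellar_other hij, mul_pow, ← pow_mul, ← pow_mul,
    mul_comm β α]
  have hi := (mem_openCube.1 hv) i
  have hj := (mem_openCube.1 hv) j
  have hpos : 0 < v i ^ (α * β) := pow_pos hi.1 _
  calc v i ^ (α * β) * v j ^ β < v i ^ (α * β) * 1 :=
        mul_lt_mul_of_pos_left (pow_lt_one₀ hj.1.le hj.2 hβ) hpos
    _ = v i ^ (α * β) := mul_one _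

/-- The two stellar charts have disjoint cube images. [folklore] -/
theorem disjoint_image_stellar_pair {i j : Fin n} (hij : i ≠ j) {α β : ℕ} (hα : α ≠ 0)
    (hβ : β ≠ 0) :
    Disjoint (monoMap (stellar i j β α) '' openCube n)
      (monoMap (stellar j i α β) '' openCube n) := by
  refine Set.disjoint_image_image fun v hv v' hv' h => ?_
  have h1 := stellar_ineq hij hβ α hv
  have h2 := stellar_ineq hij.symm hα β hv'
  rw [h] at h1
  exact lt_asymm h1 h2

/-- `β`-th roots inside `(0,1)`. [folklore] -/
theorem exists_pow_eq_of_mem_Ioo {x : ℝ} (hx0 : 0 < x) (hx1 : x < 1) {β : ℕ} (hβ : β ≠ 0) :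
    ∃ t : ℝ, 0 < t ∧ t < 1 ∧ t ^ β = x :=
  ⟨x ^ (β⁻¹ : ℝ), Real.rpow_pos_of_pos hx0 _,
    Real.rpow_lt_one hx0.le hx1 (inv_pos.2 (Nat.cast_pos.2 (Nat.pos_of_ne_zero hβ))),
    Real.rpow_inv_natCast_pow hx0.le hβ⟩

/-- The stellar chart covers `{w ∈ (0,1)ⁿ : wⱼ^β < wᵢ^α}`. [folklore] -/
theorem mem_image_stellar {i j : Fin n} (hij : i ≠ j) {β : ℕ} (hβ : β ≠ 0) (α : ℕ)
    {w : Fin n → ℝ} (hw : w ∈ openCube n) (hlt : w j ^ β < w i ^ α) :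
    w ∈ monoMap (stellar i j β α) '' openCube n := by
  have hwi := (mem_openCube.1 hw) i
  have hwj := (mem_openCube.1 hw) j
  obtain ⟨t, ht0, ht1, hti⟩ := exists_pow_eq_of_mem_Ioo hwi.1 hwi.2 hβ
  have htα : 0 < t ^ α := pow_pos ht0 _
  have hjt : w j < t ^ α := by
    apply lt_of_pow_lt_pow_left₀ β htα.le
    rw [← pow_mul, mul_comm α β, pow_mul, hti]
    exact hlt
  refine ⟨Function.update (Function.update w i t) j (w j / t ^ α), ?_, ?_⟩
  · rw [mem_openCube]
    intro k
    by_cases hkj : k = j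
    · rw [hkj, Function.update_self]
      exact ⟨div_pos hwj.1 htα, (div_lt_one htα).2 hjt⟩
    · rw [Function.update_of_ne hkj]
      by_cases hki : k = i
      · rw [hki, Function.update_self]; exact ⟨ht0, ht1⟩
      · rw [Function.update_of_ne hki]; exact (mem_openCube.1 hw) k
  · funext k
    rw [monoMap_stellar_apply i j hij]
    by_cases hki : k = i
    · rw [if_pos hki, hki, Function.update_of_ne hij, Function.update_self, hti]
    · rw [if_neg hki]
      by_cases hkj : k = j
      · rw [if_pos hkj, hkj, Function.update_of_ne hij, Function.update_self,
          Function.update_self]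
        field_simp
      · rw [if_neg hkj, Function.update_of_ne hkj, Function.update_of_ne hki]

/-- The common boundary `{wⱼ^β = wᵢ^α}` of the stellar pair is the image of the hyperplane
`{vⱼ = 1}` under the stellar chart. [folklore] -/
theorem mem_image_stellar_hyperplane {i j : Fin n} (hij : i ≠ j) {β : ℕ} (hβ : β ≠ 0) (α : ℕ)
    {w : Fin n → ℝ} (hw : w ∈ openCube n) (heq : w j ^ β = w i ^ α) :
    w ∈ monoMap (stellar i j β α) '' {v | v j = 1} := by
  have hwi := (mem_openCube.1 hw) i
  have hwj := (mem_openCube.1 hw) j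
  obtain ⟨t, ht0, _, hti⟩ := exists_pow_eq_of_mem_Ioo hwi.1 hwi.2 hβ
  have hjt : w j = t ^ α := by
    rw [← pow_left_inj₀ hwj.1.le (pow_nonneg ht0.le _) hβ, ← pow_mul, mul_comm α β, pow_mul,
      hti]
    exact heq
  refine ⟨Function.update (Function.update w i t) j 1, by simp, ?_⟩
  funext k
  rw [monoMap_stellar_apply i j hij]
  by_cases hki : k = i
  · rw [if_pos hki, hki, Function.update_of_ne hij, Function.update_self, hti]
  · rw [if_neg hki]
    by_cases hkj : k = j
    · rw [if_pos hkj, hkj, Function.update_of_ne hij, Function.update_self,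
        Function.update_self, mul_one, hjt]
    · rw [if_neg hkj, Function.update_of_ne hkj, Function.update_of_ne hki]

/-- The stellar pair covers the open cube up to a Lebesgue-null set. [folklore] -/
theorem volume_diff_stellar_pair {i j : Fin n} (hij : i ≠ j) {α β : ℕ} (hα : α ≠ 0)
    (hβ : β ≠ 0) :
    volume (openCube n \ (monoMap (stellar i j β α) '' openCube n ∪
      monoMap (stellar j i α β) '' openCube n)) = 0 := by
  have hnull : volume {v : Fin n → ℝ | v j = 1} = 0 := by
    rw [MeasureTheory.volume_pi]
    exact Measure.pi_hyperplane _ j 1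
  refine measure_mono_null ?_ (volume_image_monoMap_null (stellar i j β α) hnull)
  rintro w ⟨hw, hnot⟩
  rcases lt_trichotomy (w j ^ β) (w i ^ α) with h | h | h
  · exact absurd (Or.inl (mem_image_stellar hij hβ α hw h)) hnot
  · exact mem_image_stellar_hyperplane hij hβ α hw h
  · exact absurd (Or.inr (mem_image_stellar hij.symm hα β hw h)) hnot

/-- The stellar pair is a good family. [folklore] -/
theorem isGoodFamily_stellar_pair {i j : Fin n} (hij : i ≠ j) {α β : ℕ} (hα : α ≠ 0)
    (hβ : β ≠ 0) : IsGoodFamily [stellar i j β α, stellar j i α β] where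
  det_ne_zero := by
    intro A hA
    simp only [List.mem_cons, List.not_mem_nil, or_false] at hA
    rcases hA with rfl | rfl
    · rw [det_stellar i j hij]; exact_mod_cast hβ
    · rw [det_stellar j i hij.symm]; exact_mod_cast hα
  pairwise_disjoint := by
    refine List.pairwise_cons.2 ⟨fun A hA => ?_, List.pairwise_singleton _ _⟩
    rw [List.mem_singleton] at hA
    subst hA
    exact disjoint_image_stellar_pair hij hα hβ
  volume_diff := by
    refine measure_mono_null (fun w hw => ?_) (volume_diff_stellar_pair hij hα hβ)
    refine ⟨hw.1, fun h => hw.2 ?_⟩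
    rcases h with h | h
    · exact Set.mem_iUnion₂.2 ⟨stellar i j β α, by simp, h⟩
    · exact Set.mem_iUnion₂.2 ⟨stellar j i α β, by simp, h⟩

end MonomialCubeChart

end Literature.AlgebraicGeometry.Resolution

end
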